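import Literature.Geometry.Lorentzian.KerrSeparatedPotentialCurvature
import HarnessLib

/-!
# The axisymmetric (`m = 0`) separated potential at low frequency: the three properties of
# Dafermos–Rodnianski–Shlapentokh-Rothman §8.7.1–§8.7.2, quantitatively

(family `gr`, infrastructure for statement **gr.S24**; namespace `Literature.Geometry.Lorentzian.Kerr`)

The proofs of Propositions 8.7.1 and 8.7.2 of Dafermos–Rodnianski–Shlapentokh-Rothman (*Decay for
solutions of the wave equation on Kerr exterior spacetimes III*, arXiv:1402.7034 = Ann. of Math.
183 (2016)) rest on three "easily verified" properties of Carter's potential `V = V₀ + V₁` in the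
bounded-frequency range (`|ω| ≤ ω_low`, `Λ ≤ ε_width⁻¹ω_high²`; in Prop. 8.7.2 moreover `m = 0`):
"for every `−∞ < α < β < ∞`, … `r ∈ [α, β] ⟹ V − ω² > 0`" (for `ω_low` small); "for sufficiently
large `r*`, independent of the frequency parameters, `V' < 0`" and moreover `(r*V)' < 0`; "for
sufficiently negative `r*`, independent of the frequency parameters, `V' > 0`". This file proves
explicit versions for the **axisymmetric potential** `V = ΛΔ/(r² + a²)² + V₁` (`m = 0`, any
`Λ ≥ 0`, any `ω` — for `m = 0` the potential does not depend on `ω`):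

* `Kerr.sepPotential_axi_eq` — `V = Λ·Δ/(r² + a²)² + V₁`; `Kerr.sepPotential₁_pos`,
  `Kerr.sepPotential₁_le_sepPotential_axi` (`0 < V₁ ≤ V` on `r > r₊`), `Kerr.sepPotential_axi_rPlus`
  (`V(r₊) = 0`).
* middle: `Kerr.sepPotential₁_ge_of_four_mul_le` (**`V₁ ≥ M/(2r³)`** for `r ≥ 4M`) and
  `Kerr.sepPotential₁_ge_near` (an explicit positive lower bound on `[r₊ + s, 4M]`).
* far: `Kerr.half_le_delta_div` (`Δ/(r² + a²) ≥ ½` for `r ≥ 20M`) and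
  `Kerr.sepPotential_axi_far_ratio` — **`(3/2)V ≤ r·(Δ/(r² + a²))·(−dV/dr)`** for
  `r ≥ 20M` (so `dV/dr < 0` and, along any tortoise radius `R` with `r*`-origin placed so that
  `r* ≥ R`, `(r*V)' ≤ −½V < 0`: the quantitative form of "`V' < 0` and `(r*V)' < 0` for
  `r* ≥ R₂*`").
* near the horizon: `Kerr.deriv_sepPotential_axi_rPlus_ge` (`dV/dr(r₊) ≥ κ_H :=
  4Mr₊(r₊ − M)(r₊² − a²)/(r₊² + a²)⁴ > 0`), `Kerr.deriv_sepPotential_axi_near`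
  (**`κ_H/2 ≤ dV/dr ≤ 24Λ/r₊³ + 184M/r₊⁴`** on `[r₊, r₊ + s_N]`, `s_N = κ_H/(2L)`,
  `L = 216Λ₁/r₊⁴ + 2896M/r₊⁵`), and the resulting two-sided bounds
  `Kerr.sepPotential_axi_near_bounds` on `Ṽ = V − V(r₊) = V` ((haty2): `Ṽ ≐ V − V|_{r=r₊}`).

No named facts (D-0026); everything is proved.

## References

* M. Dafermos, I. Rodnianski, Y. Shlapentokh-Rothman, arXiv:1402.7034 = Ann. of Math. 183 (2016),
  §6.2 ((V0def)–(V1def)), §8.7.1–§8.7.2 (the three bullet properties of `V` in the proofs of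
  Props. 8.7.1, 8.7.2; the constants `R₁*`, `R₂*`) (key `DafermosRodnianskiShlapentokhrothman2014`).
-/

noncomputable section

open Set

namespace Literature.Geometry.Lorentzian

namespace Kerr

/-! ### The axisymmetric potential `V = ΛΔ/(r² + a²)² + V₁` -/

/-- For `m = 0`: `V₀ = ΛΔ/(r² + a²)²` (DRSR arXiv:1402.7034, (V0def) with `m = 0`). [cite: DafermosRodnianskiShlapentokhrothman2014, §6.2] -/
theorem sepPotential₀_axi_eq (M a ω Λ r : ℝ) :
    sepPotential₀ M a ω 0 Λ r = Λ * (delta M a r / (r ^ 2 + a ^ 2) ^ 2) := by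
  unfold sepPotential₀
  push_cast
  ring

/-- For `m = 0`: `V = ΛΔ/(r² + a²)² + V₁`; in particular the axisymmetric potential does not
depend on `ω`. [cite: DafermosRodnianskiShlapentokhrothman2014, §6.2] -/
theorem sepPotential_axi_eq (M a ω Λ r : ℝ) :
    sepPotential M a ω 0 Λ r = Λ * (delta M a r / (r ^ 2 + a ^ 2) ^ 2) + sepPotential₁ M a r := by
  rw [sepPotential, sepPotential₀_axi_eq]

/-- For `m = 0` the critical-point cubic is `P = −2Λ(r³ + a²r − 3Mr² + Ma²)`. [folklore] -/
theorem critPoly_axi_eq (M a ω Λ r : ℝ) :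
    critPoly M a ω 0 Λ r = -2 * Λ * (r ^ 3 + a ^ 2 * r - 3 * M * r ^ 2 + M * a ^ 2) := by
  unfold critPoly
  push_cast
  ring

/-- `V(r₊) = 0` for `m = 0` (`ω² − V(r₊) = (ω − ω₊m)² = ω²`). [cite: DafermosRodnianskiShlapentokhrothman2014, §6.2] -/
theorem sepPotential_axi_rPlus {M a : ℝ} (h : |a| ≤ M) (hM : 0 < M) (ω Λ : ℝ) :
    sepPotential M a ω 0 Λ (rPlus M a) = 0 := by
  have h1 := omega_sq_sub_sepPotential_rPlus h hM ω 0 Λ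
  push_cast at h1
  simp only [mul_zero, sub_zero] at h1
  have hrp0 : 0 < rPlus M a := hM.trans_le (M_le_rPlus M a)
  have e : (2 * M * rPlus M a * ω) ^ 2 / (4 * M ^ 2 * rPlus M a ^ 2) = ω ^ 2 := by
    field_simp
    ring
  linarith

/-- **`V₁ > 0` strictly on `r > r₊`** (`|a| < M`): `V₁ = Δ(a²Δ + 2Mr(r² − a²))/(r² + a²)⁴` with
`Δ > 0` and `r² > a²`. [cite: DafermosRodnianskiShlapentokhrothman2014, §6.2] -/
theorem sepPotential₁_pos {M a r : ℝ} (hMa : IsSubextremal M a) (hr : rPlus M a < r) :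
    0 < sepPotential₁ M a r := by
  have hM := hMa.pos
  have haM : |a| ≤ M := le_of_lt hMa
  have hrp : M ≤ rPlus M a := M_le_rPlus M a
  have hr0 : 0 < r := by linarith
  have hD : 0 < r ^ 2 + a ^ 2 := by positivity
  rw [sepPotential₁_eq M a hD.ne']
  have hΔ := delta_pos haM hr
  have ha2 : a ^ 2 < r ^ 2 := by
    have : |a| < r := lt_of_le_of_lt haM (by linarith)
    nlinarith [abs_nonneg a, sq_abs a]
  have hN : 0 < a ^ 2 * delta M a r + 2 * M * r * (r ^ 2 - a ^ 2) := by
    have h1 : 0 ≤ a ^ 2 * delta M a r := mul_nonneg (sq_nonneg a) hΔ.le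
    have h2 : 0 < 2 * M * r * (r ^ 2 - a ^ 2) := by
      have : 0 < r ^ 2 - a ^ 2 := by linarith
      positivity
    linarith
  positivity

/-- `V₁ ≤ V` on `r ≥ r₊` for `m = 0` and `Λ ≥ 0` (`ΛΔ/(r² + a²)² ≥ 0`). [folklore] -/
theorem sepPotential₁_le_sepPotential_axi {M a r : ℝ} (haM : |a| ≤ M) (hr : rPlus M a ≤ r)
    {Λ : ℝ} (hΛ : 0 ≤ Λ) (ω : ℝ) :
    sepPotential₁ M a r ≤ sepPotential M a ω 0 Λ r := by
  rw [sepPotential_axi_eq]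
  have : 0 ≤ Λ * (delta M a r / (r ^ 2 + a ^ 2) ^ 2) :=
    mul_nonneg hΛ (div_nonneg (delta_nonneg haM hr) (by positivity))
  linarith

/-- `V > 0` on `r > r₊` for `m = 0`, `Λ ≥ 0`, `|a| < M`. [folklore] -/
theorem sepPotential_axi_pos {M a r : ℝ} (hMa : IsSubextremal M a) (hr : rPlus M a < r)
    {Λ : ℝ} (hΛ : 0 ≤ Λ) (ω : ℝ) : 0 < sepPotential M a ω 0 Λ r :=
  (sepPotential₁_pos hMa hr).trans_le (sepPotential₁_le_sepPotential_axi (le_of_lt hMa) hr.le hΛ ω)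

/-! ### The middle region: explicit lower bounds for `V₁` -/

/-- **`V₁ ≥ M/(2r³)` for `r ≥ 4M`** (`0 < M`, `|a| ≤ M`): there `Δ ≥ r²/2`, `r² − a² ≥ 15r²/16`
and `r² + a² ≤ 17r²/16`. [folklore] -/
theorem sepPotential₁_ge_of_four_mul_le {M a r : ℝ} (hM : 0 < M) (haM : |a| ≤ M)
    (hr : 4 * M ≤ r) : M / (2 * r ^ 3) ≤ sepPotential₁ M a r := by
  have hr0 : 0 < r := by linarith
  have hD : 0 < r ^ 2 + a ^ 2 := by positivity
  have ha2 : a ^ 2 ≤ M ^ 2 := by nlinarith [sq_abs a, abs_nonneg a]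
  have hM2 : 16 * M ^ 2 ≤ r ^ 2 := by nlinarith
  have ha2r : 16 * a ^ 2 ≤ r ^ 2 := by linarith
  rw [sepPotential₁_eq M a hD.ne']
  have hΔ : r ^ 2 / 2 ≤ delta M a r := by unfold delta; nlinarith [sq_nonneg a]
  have hΔ0 : 0 ≤ delta M a r := by linarith [sq_nonneg r]
  have hN : 15 / 8 * M * r ^ 3 ≤ a ^ 2 * delta M a r + 2 * M * r * (r ^ 2 - a ^ 2) := by
    have h1 : 0 ≤ a ^ 2 * delta M a r := mul_nonneg (sq_nonneg a) hΔ0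
    have h2 : 15 / 16 * r ^ 2 ≤ r ^ 2 - a ^ 2 := by linarith
    nlinarith [mul_le_mul_of_nonneg_left h2 (show 0 ≤ 2 * M * r by positivity)]
  have hden : (r ^ 2 + a ^ 2) ^ 4 ≤ (17 / 16) ^ 4 * r ^ 8 := by
    have h1 : r ^ 2 + a ^ 2 ≤ 17 / 16 * r ^ 2 := by linarith
    calc (r ^ 2 + a ^ 2) ^ 4 ≤ (17 / 16 * r ^ 2) ^ 4 := by gcongr
      _ = (17 / 16) ^ 4 * r ^ 8 := by ring
  rw [div_le_iff₀ (by positivity), div_mul_eq_mul_div, div_mul_eq_mul_div,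
    le_div_iff₀ (by positivity)]
  -- M (r²+a²)⁴ ≤ 2r³ · Δ · N
  have hprod : r ^ 2 / 2 * (15 / 8 * M * r ^ 3) ≤
      delta M a r * (a ^ 2 * delta M a r + 2 * M * r * (r ^ 2 - a ^ 2)) :=
    mul_le_mul hΔ hN (by positivity) hΔ0
  calc M * (r ^ 2 + a ^ 2) ^ 4 ≤ M * ((17 / 16) ^ 4 * r ^ 8) := by gcongr
    _ ≤ r ^ 2 / 2 * (15 / 8 * M * r ^ 3) * (2 * r ^ 3) := by nlinarith [pow_pos hr0 8]
    _ ≤ delta M a r * (a ^ 2 * delta M a r + 2 * M * r * (r ^ 2 - a ^ 2)) * (2 * r ^ 3) := by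
        gcongr

/-- **An explicit lower bound for `V₁` near the horizon side of the middle region**: for
`r₊ + s ≤ r ≤ 4M` (`0 < s`, `|a| < M`),
`V₁ ≥ s·(r₊ − r₋)·2Mr₊(r₊² − a²)/(17M²)⁴` (`Δ = (r − r₊)(r − r₋) ≥ s(r₊ − r₋)`,
`a²Δ + 2Mr(r² − a²) ≥ 2Mr₊(r₊² − a²)`, `r² + a² ≤ 17M²`). [folklore] -/
theorem sepPotential₁_ge_near {M a r s : ℝ} (hMa : IsSubextremal M a) (hs : 0 < s)
    (hr : rPlus M a + s ≤ r) (hr4 : r ≤ 4 * M) :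
    s * (rPlus M a - rMinus M a) * (2 * M * rPlus M a * (rPlus M a ^ 2 - a ^ 2)) /
        (17 * M ^ 2) ^ 4 ≤ sepPotential₁ M a r := by
  have hM := hMa.pos
  have haM : |a| ≤ M := le_of_lt hMa
  have hrpM : M ≤ rPlus M a := M_le_rPlus M a
  have hrp0 : 0 < rPlus M a := hM.trans_le hrpM
  have hr0 : 0 < r := by linarith
  have hD : 0 < r ^ 2 + a ^ 2 := by positivity
  have ha2 : a ^ 2 ≤ M ^ 2 := by nlinarith [sq_abs a, abs_nonneg a]
  have hsq : 0 < M ^ 2 - a ^ 2 := by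
    have := hMa; unfold IsSubextremal at this
    nlinarith [abs_nonneg a, sq_abs a]
  have hroot : 0 < √(M ^ 2 - a ^ 2) := Real.sqrt_pos.2 hsq
  have hpm : rPlus M a - rMinus M a = 2 * √(M ^ 2 - a ^ 2) := by unfold rPlus rMinus; ring
  have hrm : r - rMinus M a ≥ rPlus M a - rMinus M a := by linarith
  have hΔ : s * (rPlus M a - rMinus M a) ≤ delta M a r := by
    rw [delta_eq_mul haM]
    have h1 : s ≤ r - rPlus M a := by linarith
    have h2 : 0 ≤ rPlus M a - rMinus M a := by rw [hpm]; positivity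
    exact mul_le_mul h1 hrm h2 (by linarith)
  have hΔ0 : 0 ≤ delta M a r := delta_nonneg haM (by linarith)
  have hra : rPlus M a ^ 2 - a ^ 2 > 0 := by
    have : |a| < rPlus M a := lt_of_le_of_lt haM (by
      unfold rPlus; linarith)
    nlinarith [abs_nonneg a, sq_abs a]
  have hN : 2 * M * rPlus M a * (rPlus M a ^ 2 - a ^ 2) ≤
      a ^ 2 * delta M a r + 2 * M * r * (r ^ 2 - a ^ 2) := by
    have h1 : 0 ≤ a ^ 2 * delta M a r := mul_nonneg (sq_nonneg a) hΔ0
    have h2 : rPlus M a ^ 2 - a ^ 2 ≤ r ^ 2 - a ^ 2 := by nlinarith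
    have h3 : 2 * M * rPlus M a ≤ 2 * M * r := by nlinarith
    nlinarith [mul_le_mul h3 h2 hra.le (by positivity)]
  have hden : (r ^ 2 + a ^ 2) ^ 4 ≤ (17 * M ^ 2) ^ 4 := by
    have : r ^ 2 + a ^ 2 ≤ 17 * M ^ 2 := by nlinarith
    gcongr
  rw [sepPotential₁_eq M a hD.ne', div_mul_eq_mul_div, div_le_div_iff₀ (by positivity) (by positivity)]
  have hnum : s * (rPlus M a - rMinus M a) * (2 * M * rPlus M a * (rPlus M a ^ 2 - a ^ 2)) ≤
      delta M a r * (a ^ 2 * delta M a r + 2 * M * r * (r ^ 2 - a ^ 2)) :=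
    mul_le_mul hΔ hN (by positivity) hΔ0
  have hnum0 : 0 ≤ s * (rPlus M a - rMinus M a) * (2 * M * rPlus M a * (rPlus M a ^ 2 - a ^ 2)) := by
    rw [hpm]; positivity
  calc s * (rPlus M a - rMinus M a) * (2 * M * rPlus M a * (rPlus M a ^ 2 - a ^ 2)) * (r ^ 2 + a ^ 2) ^ 4
      ≤ s * (rPlus M a - rMinus M a) * (2 * M * rPlus M a * (rPlus M a ^ 2 - a ^ 2)) * (17 * M ^ 2) ^ 4 := by
        gcongr
    _ ≤ delta M a r * (a ^ 2 * delta M a r + 2 * M * r * (r ^ 2 - a ^ 2)) * (17 * M ^ 2) ^ 4 := by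
        gcongr


/-- `Δ/(r² + a²) ≥ ½` for `r ≥ 20M` (`|a| ≤ M`, `0 < M`): far out the tortoise coordinate and `r`
advance at comparable rates (`dR/dr* = Δ/(R² + a²) ∈ [½, 1]`). [folklore] -/
theorem half_le_delta_div {M a r : ℝ} (hM : 0 < M) (haM : |a| ≤ M) (hr : 20 * M ≤ r) :
    1 / 2 ≤ delta M a r / (r ^ 2 + a ^ 2) := by
  have hr0 : 0 < r := by linarith
  have ha2 : a ^ 2 ≤ M ^ 2 := by nlinarith [sq_abs a, abs_nonneg a]
  rw [le_div_iff₀ (by positivity)]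
  unfold delta
  nlinarith

/-! ### The far region: `(3/2)V ≤ rΔ/(r² + a²)·(−dV/dr)` for `r ≥ 20M` -/

/-- The `Δ`-part: `(3/2)(r² + a²)² ≤ 2r(r³ + a²r − 3Mr² + Ma²)` for `r ≥ 20M`, `|a| ≤ M`.
[folklore] -/
theorem axi_far_delta_part {M a r : ℝ} (hM : 0 < M) (haM : |a| ≤ M) (hr : 20 * M ≤ r) :
    3 / 2 * (r ^ 2 + a ^ 2) ^ 2 ≤ 2 * r * (r ^ 3 + a ^ 2 * r - 3 * M * r ^ 2 + M * a ^ 2) := by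
  have hr0 : 0 < r := by linarith
  have ha2 : a ^ 2 ≤ M ^ 2 := by nlinarith [sq_abs a, abs_nonneg a]
  have hM2 : 400 * M ^ 2 ≤ r ^ 2 := by nlinarith
  have e1 : 6 * M * r ^ 3 ≤ 6 / 20 * r ^ 4 := by nlinarith [pow_pos hr0 3]
  have e2 : a ^ 2 * r ^ 2 ≤ r ^ 4 / 400 := by nlinarith [pow_pos hr0 2]
  have e3 : a ^ 4 ≤ r ^ 4 / 160000 := by
    have : a ^ 2 ≤ r ^ 2 / 400 := by nlinarith
    nlinarith [sq_nonneg a]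
  nlinarith [mul_nonneg (mul_nonneg hM.le (sq_nonneg a)) hr0.le]

/-- The `V₁`-part: `(3/2)(a²Δ + 2Mr(r² − a²))(r² + a²)² ≤ r·(−P₁)` for `r ≥ 20M`, `|a| ≤ M`
(`P₁ = (r² + a²)⁵ dV₁/dr`). [folklore] -/
theorem axi_far_V₁_part {M a r : ℝ} (hM : 0 < M) (haM : |a| ≤ M) (hr : 20 * M ≤ r) :
    3 / 2 * ((a ^ 2 * delta M a r + 2 * M * r * (r ^ 2 - a ^ 2)) * (r ^ 2 + a ^ 2) ^ 2) ≤
      r * (-critPoly₁ M a r) := by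
  have hr0 : 0 < r := by linarith
  have ha2 : a ^ 2 ≤ M ^ 2 := by nlinarith [sq_abs a, abs_nonneg a]
  have ha4 : a ^ 4 ≤ M ^ 4 := by nlinarith
  have ha6 : a ^ 6 ≤ M ^ 6 := by
    calc a ^ 6 = a ^ 4 * a ^ 2 := by ring
      _ ≤ M ^ 4 * M ^ 2 := mul_le_mul ha4 ha2 (sq_nonneg a) (by positivity)
      _ = M ^ 6 := by ring
  have ha8 : a ^ 8 ≤ M ^ 8 := by
    calc a ^ 8 = (a ^ 4) ^ 2 := by ring
      _ ≤ (M ^ 4) ^ 2 := pow_le_pow_left₀ (by positivity) ha4 2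
      _ = M ^ 8 := by ring
  have hM20 : M ≤ r / 20 := by linarith
  have key : r * (-critPoly₁ M a r) -
      3 / 2 * ((a ^ 2 * delta M a r + 2 * M * r * (r ^ 2 - a ^ 2)) * (r ^ 2 + a ^ 2) ^ 2) =
      3 * M * r ^ 7 - (16 * M ^ 2 - 5 / 2 * a ^ 2) * r ^ 6 - 30 * M * a ^ 2 * r ^ 5 +
        (64 * M ^ 2 * a ^ 2 + 7 / 2 * a ^ 4) * r ^ 4 - 21 * M * a ^ 4 * r ^ 3 -
        (16 * M ^ 2 * a ^ 4 + 1 / 2 * a ^ 6) * r ^ 2 + 12 * M * a ^ 6 * r - 3 / 2 * a ^ 8 := by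
    unfold critPoly₁ delta
    ring
  rw [← sub_nonneg, key]
  -- monomial bounds from `M ≤ r/20` and `a² ≤ M²`
  have e1 : M ^ 2 * r ^ 6 ≤ M * r ^ 7 / 20 := by
    calc M ^ 2 * r ^ 6 = M * r ^ 6 * M := by ring
      _ ≤ M * r ^ 6 * (r / 20) := by gcongr
      _ = M * r ^ 7 / 20 := by ring
  have e2 : M ^ 3 * r ^ 5 ≤ M * r ^ 7 / 400 := by
    calc M ^ 3 * r ^ 5 = M * r ^ 5 * (M * M) := by ring
      _ ≤ M * r ^ 5 * (r / 20 * (r / 20)) := by gcongr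
      _ = M * r ^ 7 / 400 := by ring
  have e3 : M ^ 5 * r ^ 3 ≤ M * r ^ 7 / 160000 := by
    calc M ^ 5 * r ^ 3 = M * r ^ 3 * (M * M * M * M) := by ring
      _ ≤ M * r ^ 3 * (r / 20 * (r / 20) * (r / 20) * (r / 20)) := by gcongr
      _ = M * r ^ 7 / 160000 := by ring
  have e4 : M ^ 6 * r ^ 2 ≤ M * r ^ 7 / 3200000 := by
    calc M ^ 6 * r ^ 2 = M * r ^ 2 * (M * M * M * M * M) := by ring
      _ ≤ M * r ^ 2 * (r / 20 * (r / 20) * (r / 20) * (r / 20) * (r / 20)) := by gcongr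
      _ = M * r ^ 7 / 3200000 := by ring
  have e5 : M ^ 8 ≤ M * r ^ 7 / 1280000000 := by
    calc M ^ 8 = M * (M * M * M * M * M * M * M) := by ring
      _ ≤ M * (r / 20 * (r / 20) * (r / 20) * (r / 20) * (r / 20) * (r / 20) * (r / 20)) := by
          gcongr
      _ = M * r ^ 7 / 1280000000 := by ring
  have f1 : M * a ^ 2 * r ^ 5 ≤ M ^ 3 * r ^ 5 := by
    calc M * a ^ 2 * r ^ 5 = M * r ^ 5 * a ^ 2 := by ring
      _ ≤ M * r ^ 5 * M ^ 2 := by gcongr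
      _ = M ^ 3 * r ^ 5 := by ring
  have f2 : M * a ^ 4 * r ^ 3 ≤ M ^ 5 * r ^ 3 := by
    calc M * a ^ 4 * r ^ 3 = M * r ^ 3 * a ^ 4 := by ring
      _ ≤ M * r ^ 3 * M ^ 4 := by gcongr
      _ = M ^ 5 * r ^ 3 := by ring
  have f3 : M ^ 2 * a ^ 4 * r ^ 2 ≤ M ^ 6 * r ^ 2 := by
    calc M ^ 2 * a ^ 4 * r ^ 2 = M ^ 2 * r ^ 2 * a ^ 4 := by ring
      _ ≤ M ^ 2 * r ^ 2 * M ^ 4 := by gcongr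
      _ = M ^ 6 * r ^ 2 := by ring
  have f4 : a ^ 6 * r ^ 2 ≤ M ^ 6 * r ^ 2 := by gcongr
  have g1 : 0 ≤ a ^ 2 * r ^ 6 := by positivity
  have g2 : 0 ≤ (64 * M ^ 2 * a ^ 2 + 7 / 2 * a ^ 4) * r ^ 4 := by positivity
  have g3 : 0 ≤ M * a ^ 6 * r := by positivity
  have hMr7 : 0 < M * r ^ 7 := by positivity
  nlinarith [e1, e2, e3, e4, e5, f1, f2, f3, f4, g1, g2, g3, ha8]

/-- **The far-region decay property, quantitative form** (DRSR arXiv:1402.7034, proof of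
Prop. 8.7.1: "Let `R₂* > R₊*` be a fixed positive constant chosen so that `r* ≥ R₂*` implies
`V' < 0` and `(r*V)' < 0`", here for the axisymmetric potential `m = 0`, any `Λ ≥ 0`): for
`r ≥ 20M`,
`(3/2)·V(r) ≤ r·(Δ/(r² + a²))·(−dV/dr)(r)`.
Read along a tortoise radius `R` (`dR/dr* = Δ/(R² + a²)`) with the origin of `r*` placed so that
`r* ≥ R`, this gives `(r*V)' ≤ −½V`, hence `V' < 0` and `(r*V)' < 0`.
[cite: DafermosRodnianskiShlapentokhrothman2014, Prop. 8.7.1 (proof)] -/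
theorem sepPotential_axi_far_ratio {M a ω Λ r : ℝ} (hM : 0 < M) (haM : |a| ≤ M) (hΛ : 0 ≤ Λ)
    (hr : 20 * M ≤ r) :
    3 / 2 * sepPotential M a ω 0 Λ r ≤
      r * (delta M a r / (r ^ 2 + a ^ 2)) * (-deriv (sepPotential M a ω 0 Λ) r) := by
  have hr0 : 0 < r := by linarith
  have hD : 0 < r ^ 2 + a ^ 2 := by positivity
  have hrp : rPlus M a ≤ r := by
    have : rPlus M a ≤ 2 * M := by
      unfold rPlus
      have : √(M ^ 2 - a ^ 2) ≤ M := by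
        rw [Real.sqrt_le_left hM.le]; nlinarith [sq_nonneg a]
      linarith
    linarith
  have hΔ0 : 0 ≤ delta M a r := delta_nonneg haM hrp
  rw [deriv_sepPotential_eq M a ω 0 Λ hD.ne', critPoly_axi_eq, sepPotential_axi_eq,
    sepPotential₁_eq M a hD.ne']
  have hA := axi_far_delta_part hM haM hr
  have hB := axi_far_V₁_part hM haM hr
  -- the two parts separately, then add
  have hpartD : 3 / 2 * (Λ * (delta M a r / (r ^ 2 + a ^ 2) ^ 2)) ≤
      r * (delta M a r / (r ^ 2 + a ^ 2)) *
        (-(-2 * Λ * (r ^ 3 + a ^ 2 * r - 3 * M * r ^ 2 + M * a ^ 2) / (r ^ 2 + a ^ 2) ^ 3)) := by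
    have hΛΔ : 0 ≤ Λ * delta M a r := mul_nonneg hΛ hΔ0
    rw [show 3 / 2 * (Λ * (delta M a r / (r ^ 2 + a ^ 2) ^ 2)) =
        Λ * delta M a r * (3 / 2 * (r ^ 2 + a ^ 2) ^ 2) / (r ^ 2 + a ^ 2) ^ 4 by
          field_simp,
      show r * (delta M a r / (r ^ 2 + a ^ 2)) *
          (-(-2 * Λ * (r ^ 3 + a ^ 2 * r - 3 * M * r ^ 2 + M * a ^ 2) / (r ^ 2 + a ^ 2) ^ 3)) =
        Λ * delta M a r * (2 * r * (r ^ 3 + a ^ 2 * r - 3 * M * r ^ 2 + M * a ^ 2)) /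
          (r ^ 2 + a ^ 2) ^ 4 by
          field_simp]
    rw [div_le_div_iff_of_pos_right (by positivity)]
    exact mul_le_mul_of_nonneg_left hA hΛΔ
  have hpart1 : 3 / 2 * (delta M a r / (r ^ 2 + a ^ 2) ^ 4 *
      (a ^ 2 * delta M a r + 2 * M * r * (r ^ 2 - a ^ 2))) ≤
      r * (delta M a r / (r ^ 2 + a ^ 2)) * (-(critPoly₁ M a r / (r ^ 2 + a ^ 2) ^ 5)) := by
    rw [show 3 / 2 * (delta M a r / (r ^ 2 + a ^ 2) ^ 4 *
        (a ^ 2 * delta M a r + 2 * M * r * (r ^ 2 - a ^ 2))) =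
        delta M a r * (3 / 2 * ((a ^ 2 * delta M a r + 2 * M * r * (r ^ 2 - a ^ 2)) *
          (r ^ 2 + a ^ 2) ^ 2)) / (r ^ 2 + a ^ 2) ^ 6 by
          field_simp,
      show r * (delta M a r / (r ^ 2 + a ^ 2)) * (-(critPoly₁ M a r / (r ^ 2 + a ^ 2) ^ 5)) =
        delta M a r * (r * (-critPoly₁ M a r)) / (r ^ 2 + a ^ 2) ^ 6 by
          field_simp]
    rw [div_le_div_iff_of_pos_right (by positivity)]
    exact mul_le_mul_of_nonneg_left hB hΔ0
  have hsum := add_le_add hpartD hpart1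
  have e : r * (delta M a r / (r ^ 2 + a ^ 2)) *
      -(-2 * Λ * (r ^ 3 + a ^ 2 * r - 3 * M * r ^ 2 + M * a ^ 2) / (r ^ 2 + a ^ 2) ^ 3 +
        critPoly₁ M a r / (r ^ 2 + a ^ 2) ^ 5) =
      r * (delta M a r / (r ^ 2 + a ^ 2)) *
        (-(-2 * Λ * (r ^ 3 + a ^ 2 * r - 3 * M * r ^ 2 + M * a ^ 2) / (r ^ 2 + a ^ 2) ^ 3)) +
      r * (delta M a r / (r ^ 2 + a ^ 2)) * (-(critPoly₁ M a r / (r ^ 2 + a ^ 2) ^ 5)) := by ring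
  rw [mul_add, e]
  exact hsum

/-- Consequence: **`dV/dr < 0` for `r ≥ 20M`** (axisymmetric potential, `Λ ≥ 0`, `|a| < M`).
[cite: DafermosRodnianskiShlapentokhrothman2014, Prop. 8.7.1 (proof)] -/
theorem deriv_sepPotential_axi_neg {M a ω Λ r : ℝ} (hMa : IsSubextremal M a) (hΛ : 0 ≤ Λ)
    (hr : 20 * M ≤ r) : deriv (sepPotential M a ω 0 Λ) r < 0 := by
  have hM := hMa.pos
  have haM : |a| ≤ M := le_of_lt hMa
  have hr0 : 0 < r := by linarith
  have hrp : rPlus M a < r := by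
    have : rPlus M a ≤ 2 * M := by
      unfold rPlus
      have : √(M ^ 2 - a ^ 2) ≤ M := by
        rw [Real.sqrt_le_left hM.le]; nlinarith [sq_nonneg a]
      linarith
    linarith
  have h := sepPotential_axi_far_ratio (ω := ω) hM haM hΛ hr
  have hV := sepPotential_axi_pos hMa hrp hΛ ω
  have hq : 0 < r * (delta M a r / (r ^ 2 + a ^ 2)) :=
    mul_pos hr0 (div_pos (delta_pos haM hrp) (by positivity))
  by_contra hcon
  have hcon' : 0 ≤ deriv (sepPotential M a ω 0 Λ) r := le_of_not_gt hcon
  have : r * (delta M a r / (r ^ 2 + a ^ 2)) * -deriv (sepPotential M a ω 0 Λ) r ≤ 0 :=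
    mul_nonpos_of_nonneg_of_nonpos hq.le (by linarith)
  linarith

/-! ### Near the horizon: `dV/dr ≥ κ_H/2 > 0` on `[r₊, r₊ + s_N]` -/

/-- The horizon slope constant `κ_H = dV₁/dr(r₊) = 4Mr₊(r₊ − M)(r₊² − a²)/(r₊² + a²)⁴`.
[cite: DafermosRodnianskiShlapentokhrothman2014, Lemma 6.4.1 (proof)] -/
def horizonSlope (M a : ℝ) : ℝ :=
  4 * M * rPlus M a * (rPlus M a - M) * (rPlus M a ^ 2 - a ^ 2) / (rPlus M a ^ 2 + a ^ 2) ^ 4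

/-- `κ_H > 0` for `|a| < M`. [cite: DafermosRodnianskiShlapentokhrothman2014, Lemma 6.4.1 (proof)] -/
theorem horizonSlope_pos {M a : ℝ} (hMa : IsSubextremal M a) : 0 < horizonSlope M a := by
  have hM := hMa.pos
  have haM : |a| ≤ M := le_of_lt hMa
  have hsq : 0 < M ^ 2 - a ^ 2 := by
    have := hMa; unfold IsSubextremal at this
    nlinarith [abs_nonneg a, sq_abs a]
  have hroot : 0 < √(M ^ 2 - a ^ 2) := Real.sqrt_pos.2 hsq
  have h1 : 0 < rPlus M a - M := by unfold rPlus; linarith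
  have hrp0 : 0 < rPlus M a := by linarith
  have hra : 0 < rPlus M a ^ 2 - a ^ 2 := by
    have : |a| < rPlus M a := lt_of_le_of_lt haM (by linarith)
    nlinarith [abs_nonneg a, sq_abs a]
  unfold horizonSlope
  positivity

/-- **`dV/dr(r₊) ≥ κ_H`** for the axisymmetric potential (`m = 0`, `Λ ≥ 0`, `|a| ≤ M`, `0 < M`):
`dV/dr(r₊) = dV₀/dr(r₊) + dV₁/dr(r₊)` with `dV₀/dr(r₊) = 2(r₊ − M)Λ/(r₊² + a²)² ≥ 0` and
`dV₁/dr(r₊) = κ_H` — the third bullet ("for sufficiently negative `r*`, independent of the frequency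
parameters, we have `V' > 0`") of DRSR arXiv:1402.7034, proof of Prop. 8.7.2, at `r = r₊`.
[cite: DafermosRodnianskiShlapentokhrothman2014, Prop. 8.7.2 (proof)] -/
theorem deriv_sepPotential_axi_rPlus_ge {M a : ℝ} (haM : |a| ≤ M) (hM : 0 < M) {Λ : ℝ}
    (hΛ : 0 ≤ Λ) (ω : ℝ) :
    horizonSlope M a ≤ deriv (sepPotential M a ω 0 Λ) (rPlus M a) := by
  have h0 := hasDerivAt_sepPotential₀_rPlus haM hM ω 0 Λ
  have h1 := deriv_sepPotential₀_rPlus_le_deriv_sepPotential_rPlus haM hM ω 0 Λ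
  have h1' := hasDerivAt_sepPotential₁_rPlus haM hM
  have hsum : HasDerivAt (sepPotential M a ω 0 Λ) _ (rPlus M a) := h0.add h1'
  rw [hsum.deriv, ← h1'.deriv, deriv_sepPotential₁_rPlus_eq haM hM]
  have hrpM : M ≤ rPlus M a := M_le_rPlus M a
  have hrp0 : 0 < rPlus M a := hM.trans_le hrpM
  have hV0 : 0 ≤ (4 * ((0 : ℤ) : ℝ) * a * M * ω * (-3 * rPlus M a ^ 2 + a ^ 2) +
      4 * rPlus M a * a ^ 2 * ((0 : ℤ) : ℝ) ^ 2 +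
      2 * (rPlus M a ^ 2 + a ^ 2) * (rPlus M a - M) * Λ) / (rPlus M a ^ 2 + a ^ 2) ^ 3 := by
    push_cast
    simp only [mul_zero, zero_mul, zero_add, ne_eq, OfNat.ofNat_ne_zero, not_false_eq_true,
      zero_pow]
    apply div_nonneg _ (by positivity)
    have : 0 ≤ rPlus M a - M := sub_nonneg.2 hrpM
    positivity
  unfold horizonSlope
  linarith

/-- The curvature constant `L(Λ₁) = 216Λ₁/r₊⁴ + 2896M/r₊⁵` bounding `|d²V/dr²|` on `r ≥ r₊` for
`Λ ≤ Λ₁`. [folklore] -/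
def horizonCurv (M a Λ₁ : ℝ) : ℝ :=
  216 * Λ₁ / rPlus M a ^ 4 + 2896 * M / rPlus M a ^ 5

/-- `|d²V/dr²| ≤ L(Λ₁)` on `r ≥ r₊` for admissible triples with `Λ ≤ Λ₁` (from
`abs_deriv_deriv_sepPotential_le`). [folklore] -/
theorem abs_deriv_deriv_sepPotential_le_horizonCurv {M a ω Λ Λ₁ r : ℝ} {m : ℤ} (hM : 0 < M)
    (haM : |a| ≤ M) (hadm : IsAdmissibleTriple a ω m Λ) (hΛ : Λ ≤ Λ₁) (hr : rPlus M a ≤ r) :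
    |deriv (deriv (sepPotential M a ω m Λ)) r| ≤ horizonCurv M a Λ₁ := by
  have hrpM : M ≤ rPlus M a := M_le_rPlus M a
  have hrp0 : 0 < rPlus M a := hM.trans_le hrpM
  have hMr : M ≤ r := hrpM.trans hr
  have hr0 : 0 < r := hM.trans_le hMr
  have hΛ0 := hadm.nonneg
  have h := abs_deriv_deriv_sepPotential_le hM haM hadm hMr
  refine h.trans ?_
  unfold horizonCurv
  have h1 : 216 * Λ / r ^ 4 ≤ 216 * Λ₁ / rPlus M a ^ 4 := by
    have : 216 * Λ / r ^ 4 ≤ 216 * Λ / rPlus M a ^ 4 := by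
      apply div_le_div_of_nonneg_left (by positivity) (by positivity)
      gcongr
    refine this.trans ?_
    gcongr
  have h2 : 2896 * M / r ^ 5 ≤ 2896 * M / rPlus M a ^ 5 := by
    apply div_le_div_of_nonneg_left (by positivity) (by positivity)
    gcongr
  linarith

/-- **`κ_H/2 ≤ dV/dr ≤ 24Λ/r₊³ + 184M/r₊⁴` on `[r₊, r₊ + s]` whenever `s·L(Λ₁) ≤ κ_H/2`**
(axisymmetric potential, `0 ≤ Λ ≤ Λ₁`, `|a| < M`): the lower bound by the mean value theorem from
`dV/dr(r₊) ≥ κ_H` and `|d²V/dr²| ≤ L`, the upper bound from `abs_deriv_sepPotential_le`.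
[cite: DafermosRodnianskiShlapentokhrothman2014, Prop. 8.7.2 (proof)] -/
theorem deriv_sepPotential_axi_near {M a ω Λ Λ₁ s r : ℝ} (hMa : IsSubextremal M a)
    (hadm : IsAdmissibleTriple a ω 0 Λ) (hΛ : Λ ≤ Λ₁)
    (hs : s * horizonCurv M a Λ₁ ≤ horizonSlope M a / 2) (hr : rPlus M a ≤ r)
    (hrs : r ≤ rPlus M a + s) :
    horizonSlope M a / 2 ≤ deriv (sepPotential M a ω 0 Λ) r ∧
      deriv (sepPotential M a ω 0 Λ) r ≤ 24 * Λ / rPlus M a ^ 3 + 184 * M / rPlus M a ^ 4 := by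
  have hM := hMa.pos
  have haM : |a| ≤ M := le_of_lt hMa
  have hrpM : M ≤ rPlus M a := M_le_rPlus M a
  have hrp0 : 0 < rPlus M a := hM.trans_le hrpM
  have hr0 : 0 < r := hrp0.trans_le hr
  have hΛ0 := hadm.nonneg
  constructor
  · -- MVT for V' on [r₊, r]
    have hκ := deriv_sepPotential_axi_rPlus_ge haM hM hΛ0 ω
    set g := deriv (sepPotential M a ω 0 Λ) with hg
    have hgd : ∀ t, rPlus M a ≤ t → HasDerivAt g (deriv g t) t := fun t ht ↦
      (hasDerivAt_deriv_sepPotential M a ω 0 Λ (hrp0.trans_le ht)).differentiableAt.hasDerivAt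
    have hbound : ∀ t ∈ interior (Icc (rPlus M a) r), -horizonCurv M a Λ₁ ≤ deriv g t := by
      intro t ht
      rw [interior_Icc] at ht
      have h := abs_deriv_deriv_sepPotential_le_horizonCurv hM haM hadm hΛ ht.1.le
      rw [hg]
      linarith [neg_abs_le (deriv (deriv (sepPotential M a ω 0 Λ)) t)]
    have hmvt := (convex_Icc (rPlus M a) r).mul_sub_le_image_sub_of_le_deriv
      (fun t ht ↦ (hgd t ht.1).continuousAt.continuousWithinAt)
      (fun t ht ↦ (hgd t (by rw [interior_Icc] at ht; exact ht.1.le)).differentiableAt.differentiableWithinAt)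
      hbound (rPlus M a) (left_mem_Icc.2 hr) r (right_mem_Icc.2 hr) hr
    have hL0 : 0 ≤ horizonCurv M a Λ₁ := by
      unfold horizonCurv
      have : 0 ≤ Λ₁ := hΛ0.trans hΛ
      positivity
    have : (r - rPlus M a) * horizonCurv M a Λ₁ ≤ s * horizonCurv M a Λ₁ :=
      mul_le_mul_of_nonneg_right (by linarith) hL0
    nlinarith
  · have h := abs_deriv_sepPotential_le hM haM hadm hr
    have h' := le_abs_self (deriv (sepPotential M a ω 0 Λ) r)
    have h1 : 24 * Λ / r ^ 3 ≤ 24 * Λ / rPlus M a ^ 3 := by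
      apply div_le_div_of_nonneg_left (by positivity) (by positivity); gcongr
    have h2 : 184 * M / r ^ 4 ≤ 184 * M / rPlus M a ^ 4 := by
      apply div_le_div_of_nonneg_left (by positivity) (by positivity); gcongr
    linarith

/-- **Two-sided bounds for `Ṽ = V − V(r₊) = V` near the horizon** (axisymmetric potential):
on `[r₊, r₊ + s]` with `s·L(Λ₁) ≤ κ_H/2`,
`(κ_H/2)(r − r₊) ≤ V(r) ≤ (24Λ/r₊³ + 184M/r₊⁴)(r − r₊)`.
[cite: DafermosRodnianskiShlapentokhrothman2014, Prop. 8.7.2 (proof)] -/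
theorem sepPotential_axi_near_bounds {M a ω Λ Λ₁ s r : ℝ} (hMa : IsSubextremal M a)
    (hadm : IsAdmissibleTriple a ω 0 Λ) (hΛ : Λ ≤ Λ₁)
    (hs : s * horizonCurv M a Λ₁ ≤ horizonSlope M a / 2) (hr : rPlus M a ≤ r)
    (hrs : r ≤ rPlus M a + s) :
    horizonSlope M a / 2 * (r - rPlus M a) ≤ sepPotential M a ω 0 Λ r ∧
      sepPotential M a ω 0 Λ r ≤ (24 * Λ / rPlus M a ^ 3 + 184 * M / rPlus M a ^ 4) * (r - rPlus M a) := by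
  have hM := hMa.pos
  have haM : |a| ≤ M := le_of_lt hMa
  have hrpM : M ≤ rPlus M a := M_le_rPlus M a
  have hrp0 : 0 < rPlus M a := hM.trans_le hrpM
  have hV0 : sepPotential M a ω 0 Λ (rPlus M a) = 0 := sepPotential_axi_rPlus haM hM ω Λ
  have hd : ∀ t, rPlus M a ≤ t → HasDerivAt (sepPotential M a ω 0 Λ)
      (deriv (sepPotential M a ω 0 Λ) t) t := fun t ht ↦
    (hasDerivAt_sepPotential M a ω 0 Λ (by have := hrp0.trans_le ht; positivity)).differentiableAt.hasDerivAt
  have hder : ∀ t ∈ Icc (rPlus M a) r, horizonSlope M a / 2 ≤ deriv (sepPotential M a ω 0 Λ) t ∧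
      deriv (sepPotential M a ω 0 Λ) t ≤ 24 * Λ / rPlus M a ^ 3 + 184 * M / rPlus M a ^ 4 :=
    fun t ht ↦ deriv_sepPotential_axi_near hMa hadm hΛ hs ht.1 (ht.2.trans hrs)
  have hcont : ContinuousOn (sepPotential M a ω 0 Λ) (Icc (rPlus M a) r) :=
    fun t ht ↦ (hd t ht.1).continuousAt.continuousWithinAt
  have hdiff : DifferentiableOn ℝ (sepPotential M a ω 0 Λ) (interior (Icc (rPlus M a) r)) :=
    fun t ht ↦ (hd t (by rw [interior_Icc] at ht; exact ht.1.le)).differentiableAt.differentiableWithinAt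
  constructor
  · have h := (convex_Icc (rPlus M a) r).mul_sub_le_image_sub_of_le_deriv hcont hdiff
      (fun t ht ↦ (hder t (interior_subset ht)).1) (rPlus M a) (left_mem_Icc.2 hr) r
      (right_mem_Icc.2 hr) hr
    rw [hV0, sub_zero] at h
    exact h
  · have h := (convex_Icc (rPlus M a) r).image_sub_le_mul_sub_of_deriv_le hcont hdiff
      (fun t ht ↦ (hder t (interior_subset ht)).2) (rPlus M a) (left_mem_Icc.2 hr) r
      (right_mem_Icc.2 hr) hr
    rw [hV0, sub_zero] at h
    exact h

end Kerr

end Literature.Geometry.Lorentzian
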